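import Literature.NumberTheory.EllipticCurves.Tian2014.CMPointSystemGenusBridge
import Literature.NumberTheory.EllipticCurves.TianYuanZhang2017.GenusDescentTwist
import Literature.GroupTheory.FiniteAbelian.TwoTorsionSquaresCard
import HarnessLib

/-!
# The Gross–Zagier index relation of the `𝒮⁻` enclosure SPLIT into its printed pieces: TYZ Thm. 3.3 at `χ₀`
# (E-side, as printed) on a point `R` (= `R_{χ₀}`), the bridge «`R_{χ₀} = ±2y + torsion`» (PROOF-A Lemma 8.1,
# the (B4) assembly, now an isolated displayed sentence), and the `2`-rank `h₂ = 2` from Gauss genus theory —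
# `GrossZagierScriptL` becomes a THEOREM of the split data

Cell `bsd-monsky` (typer seat, g2; `run/shared/lean/pub/bsd-monsky/lean/PLAN.md` v0.8, K2-light). HONEST FRAMING:
nothing asserted. The landed predicate `CMPointData.GrossZagierScriptL` («`y_{2n} ≐ ±𝓛(1)𝓛(2n)·g`») is the
(B4)-FLAGGED assembly of three printed inputs plus `2`-adic bookkeeping. This file displays the inputs
separately, on the same data `D : CMPointData n` with one more point `R`:
* `tyzThm33Chi0`: Tian–Yuan–Zhang 2017, Thm. 3.3 at `χ = χ₀ = χ_{2n,1}` ("`d₁ = 1`" is allowed, Lemma 3.14,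
  "In the last case `d₁ = 1`", p. 750), E-side form of the proof (p. 751, verbatim): "`R_χ = ε(d₀,d₁)2^{h₂(n)}𝓛(d₁)𝓡(d₀)
  ∈ E(H′_n(i)) ⊗_ℤ ℚ`. Here `R_χ = ϕ(P_χ)` and `𝓡(d₀) = ϕ(𝒫(d₀))`. … If `𝓛(d₀) ≠ 0` … `𝓡(d₀) = 2⁻¹𝓛(d₀)β_{d₀}
  ∈ E(K_{d₀})⁻_ℚ`, where `β_{d₀} ∈ E(K_{d₀})⁻` is any `ℤ`-basis of the free part of `E(K_{d₀})⁻`", with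
  "`ε(d₀, d₁) = ±1`" for `(d₀, d₁) ≡ (6, 1) (mod 8)` (Thm. 3.3, p. 739) and "`h₂(n) = dim_{𝔽₂} Cl_n/2Cl_n`"
  (p. 756). Rendering: equality in `E ⊗ ℚ` = the difference of twice both sides is torsion; `β` = the transfer of a
  generator `g` of `E_{2n}(ℚ)/tor` (the printed `E(K)⁻ ≅ E_{2n}(ℚ)`, Tian Thm. 1.5 — the convention of the landed
  predicate); `2^{h₂}·#(2Cl) = #Cl` is the definition of `h₂` through the genus class number `#(2Cl)`.
* `bridgeLemma81`: "`R_{χ₀} = ±2y + (a torsion point)`" for every transversal `φ` — PROOF-A v3.4 Lemma 8.1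
  (the identification of Tian's `z`, `y` with TYZ's `z_N`, `R_{χ₀}` through Tian Prop. 2.1–2.2, TYZ Prop. 3.2 /
  Thm. 3.6 / Lemma 3.16; referee PASS ×2). THIS is the (B4) assembly, now one displayed sentence; it carries the flag.
* `GrossZagierSplit`: `∃ R L u h₂`, `L² = 𝓛(2n)²`, `u² = 𝓛(1)²`, `u` odd (TYZ Thm. 1.1 at `n = 1`, Thm. 1.2 = journal
  Thm. 1.4: "`𝓛(n)` is an integer"), `tyzThm33Chi0 ∧ bridgeLemma81`.
THEOREMS: `h₂ = 2` on `𝒮⁻` from `GenusTheoryDisplays` (`𝒜[2] = {1, [ϖ′], [𝔭_p], [𝔭_q]}` distinct, first isomorphism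
theorem for squaring: `#Cl = #Cl[2]·#(2Cl)`), and `GrossZagierScriptL` from `GrossZagierSplit` (torsion bookkeeping:
`2R ≐ ±4uL·β`, `R ≐ ±2y` ⟹ `4(±uL·β ∓ y) ≐ 0` ⟹ `y ≐ ±uL·g` through the injective transfer). The restated
system fact `tian2014_system_sMinus_split` implies the landed `tian2014_system_sMinus_genus`.
[cite: TianYuanZhang2017, Thm. 3.3 (p. 739), its proof (pp. 749–751), Lemma 3.14 (p. 748), p. 756 (h₂), Thm. 1.1, Thm. 1.4]
[cite: Tian2014, (4.6)_J = (4.5) (p0022 L84–L96), Prop. 2.1–2.2 (J124–J126), Thm. 1.5 (p0003 L25–L27), Notations (i) (J122)]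
-/

noncomputable section

open scoped Classical NumberTheorySymbols

open WeierstrassCurve NumberField Literature.NumberTheory.EllipticCurves
  Literature.NumberTheory.EllipticCurves.TianYuanZhang2017 Literature.GroupTheory.FiniteAbelian

namespace Literature.NumberTheory.EllipticCurves.Tian2014

/-! ## §1 The transfer is injective (plumbing) -/

/-- The transfer `E_N(ℚ) →+ E(H)` is injective (an isomorphism onto its image `E(ℚ(θ))⁻`). [cite: Tian2014, Thm. 1.5 (p0003 L25–L27)] [folklore] -/
theorem transferE_injective (N : ℕ) {H : Type} [Field H] [CharZero H] (θ : H)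
    (hθ2 : θ ^ 2 = algebraMap ℚ H (-(N : ℚ))) (hθ : θ ≠ 0) :
    Function.Injective (transferE N θ hθ2 hθ) := by
  intro a b h
  simp only [transferE, AddMonoidHom.comp_apply, AddEquiv.coe_toAddMonoidHom] at h
  exact (Affine.Point.congrEquiv (congruentNumberCurve_eq_quadraticTwist N)).injective
    (TianYuanZhang2017.W2.ιK_injective _ _ ((untwistEquivAt (congruentNumberCurve 1) hθ2 hθ).injective h))

namespace CMPointData

variable {n : ℕ}

/-- `D.transfer` is injective. [cite: Tian2014, Thm. 1.5 (p0003 L25–L27)] [folklore] -/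
theorem transfer_injective (D : CMPointData n) (hn : n ≠ 0) : Function.Injective (D.transfer hn) :=
  transferE_injective _ _ _ _

/-! ## §2 The two printed pieces, displayed on the data with one more point `R` -/

/-- **Tian–Yuan–Zhang 2017, Thm. 3.3 at `χ₀` (`(d₀, d₁) = (2n, 1)`), E-side, AS PRINTED, on a point `R`** (the
point `R_{χ₀} = ϕ(P_{χ₀}) ∈ E(H′_n(i))` of the source): with `L² = 𝓛(2n)²`, `u² = 𝓛(1)²` and `h₂` the `2`-rank of
`𝒜 = Cl(ℚ(√−2n))` ("`h₂(n) = dim_{𝔽₂} Cl_n/2Cl_n`", rendered `2^{h₂}·#(2𝒜) = #𝒜`), for every generator `g` of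
`E_{2n}(ℚ)/tor` (`β = transfer g`, "any `ℤ`-basis of the free part of `E(K_{d₀})⁻`") there is `ε = ±1` with
`2R − ε·2^{h₂}·u·L·β` torsion — "`R_χ = ε(d₀,d₁)2^{h₂(n)}𝓛(d₁)·2⁻¹𝓛(d₀)β_{d₀}` in `E(H′_n(i)) ⊗_ℤ ℚ`", "`ε = ±1`
otherwise [than `(5, 3)`]". Nothing about the construction of `R` is displayed.
[cite: TianYuanZhang2017, Thm. 3.3 (p. 739) and its proof (p. 751: R_χ, 𝓡(d₀) = 2⁻¹𝓛(d₀)β), Lemma 3.14 (p. 748), p. 756 (h₂(n))]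
[cite: Tian2014, Thm. 1.5 (p0003 L25–L27)] -/
def tyzThm33Chi0 (D : CMPointData n) (hn : n ≠ 0) (R : EPoint D.H) (L u : ℤ) (h₂ : ℕ) : Prop :=
  2 ^ h₂ * genusClassNumber (GenusField (2 * n)) = Nat.card (ClassGroup (𝓞 (GenusField (2 * n)))) ∧
  ∀ g : (congruentNumberCurve (2 * n)).toAffine.Point,
    (∀ w : (congruentNumberCurve (2 * n)).toAffine.Point, ∃ m : ℤ, IsOfFinAddOrder (w - m • g)) →
    ∃ ε : ℤ, (ε = 1 ∨ ε = -1) ∧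
      IsOfFinAddOrder ((2 : ℤ) • R - (ε * 2 ^ h₂ * u * L) • D.transfer hn g)

/-- **The bridge «`R_{χ₀} = ±2y + (a torsion point)`» (PROOF-A v3.4, Lemma 8.1 — the (B4) assembly: Tian's
`z = f(P) + (1+√2, 2+√2)`, `y_{2n,φ} = Σ_φ z_t` against TYZ's `z_N = f_N(P_N)`, `R_{χ₀} = ϕ(Σ_Φ z_N^t)`, through
Tian Prop. 2.1–2.2 (`T(A) = t_{[0],−1}`, `T(B)` of order `4`), TYZ Prop. 3.2, Thm. 3.6, Lemma 3.16 and the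
identification `f = ±ϕ∘i₀`; referee PASS ×2)**, for every set of representatives `φ`: `R − (±2)·y_{2n,φ}` is
torsion. A DISPLAYED ASSEMBLY, not a single printed sentence — it carries the (B4) flag of the enclosure.
[cite: Tian2014, Def. 2.7 (p0011 L25–L36), Prop. 2.1–2.2 (J124–J126), (4.5) = journal (4.6) (p0022 L84–L96), p0027 L62–L64]
[cite: TianYuanZhang2017, Prop. 3.2 (p. 738), Thm. 3.6 (p. 741), Lemma 3.16 (p. 754), p. 749 (2P_χ = Σ_{Cl_n} (2f_n(P_n))^t χ(t))] -/
def bridgeLemma81 (D : CMPointData n) (R : EPoint D.H) : Prop :=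
  ∀ φ, D.IsRepsModPiPrime φ → ∃ s : ℤ, (s = 1 ∨ s = -1) ∧ IsOfFinAddOrder (R - (s * 2) • D.yPoint φ)

/-- **The Gross–Zagier index relation, SPLIT**: a point `R` (= `R_{χ₀}`), integers `L` (`L² = 𝓛(2n)²`, TYZ Thm. 1.4)
and `u` (`u² = 𝓛(1)²`, `u` odd: TYZ Thm. 1.1 at `n = 1`, "The right-hand side is considered to be `1` if `n = 1`"),
the `2`-rank `h₂`, with `tyzThm33Chi0` (printed) and `bridgeLemma81` (the flagged assembly).
[cite: TianYuanZhang2017, Thm. 1.1 (p0002 L90–L99), Thm. 1.4 (journal) = Thm. 1.2 (arXiv), Thm. 3.3 (p. 739)] -/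
def GrossZagierSplit (D : CMPointData n) (hn : n ≠ 0) : Prop :=
  ∃ (R : EPoint D.H) (L u : ℤ) (h₂ : ℕ), IsScriptL (2 * n) L ∧ IsScriptL 1 u ∧ Odd u ∧
    D.tyzThm33Chi0 hn R L u h₂ ∧ D.bridgeLemma81 R

/-! ## §3 `h₂ = 2` on `𝒮⁻` from Gauss genus theory as printed -/

/-- **`h₂(2pq) = 2` on `𝒮⁻`**: `𝒜[2] = {1, [ϖ′], [𝔭_p], [𝔭_q]}` with the four classes pairwise distinct (the Artin
symbols of `[𝔭_p]`, `[𝔭_q]` on `√p`, `√−q` differ by the genus rule — Tian Notations (iii)), so `#𝒜[2] = 4` and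
`#𝒜 = #𝒜[2]·#(2𝒜)` gives `2^{h₂} = 4`. ("`𝒜[2]` has cardinality `2^{k+1}`", `k + 1 = 2`.)
[cite: Tian2014, Notations (i)–(iii) (J122 L41–54 = p0005 L22–L41)] [cite: TianYuanZhang2017, p. 756 (h₂(n))] -/
theorem twoRank_eq_two_of_genusTheoryDisplays {p q : ℕ} (D : CMPointData (p * q)) (hP : D.Printed)
    (hp : p.Prime) (hq : q.Prime) (hp8 : p % 8 = 5) (hq4 : q % 4 = 3) (hpq : jacobiSym p q = -1)
    (hG : D.GenusTheoryDisplays) {h₂ : ℕ}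
    (hh : 2 ^ h₂ * genusClassNumber (GenusField (2 * (p * q))) =
      Nat.card (ClassGroup (𝓞 (GenusField (2 * (p * q)))))) : h₂ = 2 := by
  obtain ⟨sqrtP, sqrtNegQ, cp, cq, hPs, hQs, hm, hcp2, hcq2, h2tor, -, r1, r2, r3, r4, -, -, -, -⟩ := hG
  obtain ⟨hsP, hsQ⟩ := Monsky1990.sqrt_ne_zero_of_prime hp hq hPs hQs
  obtain ⟨hcpP, hcpQ, hcqP, -⟩ :=
    Monsky1990.ramifiedClassActions_of_genusRule D.art hp8 hq4 hpq hPs hQs r1 r2 r3 r4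
  obtain ⟨-, -, -, -, -, -, -, -, -, hπ2, hπ1⟩ := hP
  have hcp1 : cp ≠ 1 := by
    intro h
    rw [h, map_one, AlgEquiv.one_apply] at hcpQ
    exact hsQ (CharZero.eq_neg_self_iff.mp hcpQ)
  have hcq1 : cq ≠ 1 := by
    intro h
    rw [h, map_one, AlgEquiv.one_apply] at hcqP
    exact hsP (CharZero.eq_neg_self_iff.mp hcqP)
  have hcpcq : cp ≠ cq := by
    intro h
    rw [h, hcqP] at hcpP
    exact hsP (CharZero.neg_eq_self_iff.mp hcpP)
  have hmcp : D.piPrime ≠ cp := by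
    intro h
    rw [hm] at h
    exact hcq1 (mul_left_cancel (h.trans (mul_one cp).symm))
  have hmcq : D.piPrime ≠ cq := by
    intro h
    rw [hm] at h
    exact hcp1 (mul_right_cancel (h.trans (one_mul cq).symm))
  exact twoRank_eq_two_of_twoTorsion_four hh h2tor hπ2 hcp2 hcq2 hπ1 hcp1 hcq1 hmcp hmcq hcpcq

/-! ## §4 `GrossZagierScriptL` is a THEOREM of the split data (torsion bookkeeping) -/

/-- **The landed index relation from the split pieces**: `2R ≐ ±2^{h₂}uL·β` (TYZ 3.3), `R ≐ ±2y` (Lemma 8.1) and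
`h₂ = 2` give `4·(±uL·β ∓ y) ≐ 0`, hence `y′ ≐ ±uL·g` for the rational point `y′` transferring to `y`.
[cite: TianYuanZhang2017, Thm. 3.3 (p. 739)] [folklore] -/
theorem grossZagierScriptL_of_grossZagierSplit {p q : ℕ} (D : CMPointData (p * q)) (hP : D.Printed)
    (hp : p.Prime) (hq : q.Prime) (hp8 : p % 8 = 5) (hq4 : q % 4 = 3) (hpq : jacobiSym p q = -1)
    (hG : D.GenusTheoryDisplays) (hS : D.GrossZagierSplit (Nat.mul_ne_zero hp.ne_zero hq.ne_zero)) :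
    D.GrossZagierScriptL (Nat.mul_ne_zero hp.ne_zero hq.ne_zero) := by
  have hn : p * q ≠ 0 := Nat.mul_ne_zero hp.ne_zero hq.ne_zero
  obtain ⟨R, L, u, h₂, hL, hu, huodd, ⟨hh, h33⟩, h81⟩ := hS
  have hh2 : h₂ = 2 := D.twoRank_eq_two_of_genusTheoryDisplays hP hp hq hp8 hq4 hpq hG hh
  subst hh2
  refine ⟨L, u, hL, hu, huodd, ?_⟩
  intro φ hφ y' hy' g hg
  obtain ⟨ε, hε, h1⟩ := h33 g hg
  obtain ⟨s, hs, h2⟩ := h81 φ hφ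
  rw [← hy'] at h2
  have hX : IsOfFinAddOrder ((2 : ℤ) • (R - (s * 2) • D.transfer hn y') -
      ((2 : ℤ) • R - (ε * 2 ^ 2 * u * L) • D.transfer hn g)) := by
    rw [sub_eq_add_neg]
    exact h2.zsmul.add h1.neg
  have hXeq : (2 : ℤ) • (R - (s * 2) • D.transfer hn y') -
      ((2 : ℤ) • R - (ε * 2 ^ 2 * u * L) • D.transfer hn g) =
      (4 : ℕ) • D.transfer hn ((ε * u * L) • g - s • y') := by
    rw [map_sub, map_zsmul, map_zsmul]
    module
  rw [hXeq] at hX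
  have hX2 : IsOfFinAddOrder (D.transfer hn ((ε * u * L) • g - s • y')) := hX.of_nsmul (by norm_num)
  have hX3 : IsOfFinAddOrder ((ε * u * L) • g - s • y') := by
    rw [isOfFinAddOrder_iff_nsmul_eq_zero] at hX2 ⊢
    obtain ⟨k, hk, hk0⟩ := hX2
    refine ⟨k, hk, D.transfer_injective hn ?_⟩
    rw [map_nsmul, hk0, map_zero]
  have hss : s * s = 1 := by rcases hs with rfl | rfl <;> norm_num
  refine ⟨s * ε, ?_, ?_⟩
  · rcases hs with rfl | rfl <;> rcases hε with rfl | rfl <;> norm_num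
  · have hsy : s • s • y' = y' := by rw [smul_smul, hss, one_smul]
    have heq : y' - (s * ε * u * L) • g = -(s • ((ε * u * L) • g - s • y')) := by
      rw [zsmul_sub, hsy]
      module
    rw [heq]
    exact hX3.zsmul.neg

end CMPointData

/-! ## §5 The restated system fact and its implication -/

/-- **THE SYSTEM FACT WITH THE GROSS–ZAGIER RELATION SPLIT**: Tian's CM-point system on `𝒮⁻` with `Printed`
(Thm. 2.8 system), `GrossZagierSplit` (TYZ Thm. 3.3 at `χ₀` as printed + the (B4)-flagged bridge Lemma 8.1 as ONE
displayed sentence + `𝓛(2n) ∈ ℤ`, `𝓛(1)` odd) and `GenusTheoryDisplays` (Tian Notations (i)–(iii)). Existential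
over ONE system per `(p, q)`; implies `tian2014_system_sMinus_genus` (`tian2014_system_sMinus_genus_of_split`),
so every enclosure theorem of the cell holds relative to it. Printed-but-unproved content = `Printed` + TYZ Thm. 3.3
(printed) + the bridge (flagged) + TYZ Thm. 1.1 / 1.4 + the 15 genus-theory conjuncts.
[cite: Tian2014, Def. 2.7, Thm. 2.8 (p0011 L25–L44 = J132), (4.8) (p0023 L46–L50), Notations (J122–123)]
[cite: TianYuanZhang2017, Thm. 3.3 (p. 739) and its proof (pp. 749–751), Thm. 1.1, Thm. 1.4] -/
def tian2014_system_sMinus_split : Prop :=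
  ∀ p q : ℕ, (hp : p.Prime) → (hq : q.Prime) → p % 8 = 5 → q % 4 = 3 → jacobiSym p q = -1 →
    ∃ D : CMPointData (p * q), D.Printed ∧
      D.GrossZagierSplit (Nat.mul_ne_zero hp.ne_zero hq.ne_zero) ∧ D.GenusTheoryDisplays

/-- The split fact implies the landed genus-form fact (`GrossZagierScriptL` is a theorem of the split data).
[cite: TianYuanZhang2017, Thm. 3.3 (p. 739)] -/
theorem tian2014_system_sMinus_genus_of_split (h : tian2014_system_sMinus_split) :
    tian2014_system_sMinus_genus := by
  intro p q hp hq hp5 hq4 hj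
  obtain ⟨D, hP, hS, hG⟩ := h p q hp hq hp5 hq4 hj
  exact ⟨D, hP, D.grossZagierScriptL_of_grossZagierSplit hP hp hq hp5 hq4 hj hG hS, hG⟩

end Literature.NumberTheory.EllipticCurves.Tian2014

end
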